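import Summits.MatrixMultiplication.OmegaCensus.SmallFormats.MatMul227GF3FootprintCerts0WA
import Summits.MatrixMultiplication.OmegaCensus.SmallFormats.MatMul227GF3FootprintCerts0WB
import Summits.MatrixMultiplication.OmegaCensus.SmallFormats.MatMul227GF3FootprintCerts0WC
import Summits.MatrixMultiplication.OmegaCensus.SmallFormats.MatMul227GF3FootprintCerts1WA
import Summits.MatrixMultiplication.OmegaCensus.SmallFormats.MatMul227GF3FootprintCerts1WB
import Summits.MatrixMultiplication.OmegaCensus.SmallFormats.MatMul227GF3FootprintCerts1WC
import Summits.MatrixMultiplication.OmegaCensus.SmallFormats.MatMul227GF3FootprintCerts2WA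
import Summits.MatrixMultiplication.OmegaCensus.SmallFormats.MatMul227GF3FootprintCerts2WB
import Summits.MatrixMultiplication.OmegaCensus.SmallFormats.MatMul227GF3FootprintCerts2WC
import Summits.MatrixMultiplication.OmegaCensus.SmallFormats.MatMul227GF3FootprintCerts0WD
import Summits.MatrixMultiplication.OmegaCensus.SmallFormats.MatMul227GF3FootprintCerts0WE
import Summits.MatrixMultiplication.OmegaCensus.SmallFormats.MatMul227GF3FootprintCerts1WD
import Summits.MatrixMultiplication.OmegaCensus.SmallFormats.MatMul227GF3FootprintCerts1WE
import Summits.MatrixMultiplication.OmegaCensus.SmallFormats.MatMul227GF3FootprintCerts2WD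
import Summits.MatrixMultiplication.OmegaCensus.SmallFormats.MatMul227GF3FootprintCerts2WE
import Summits.MatrixMultiplication.OmegaCensus.SmallFormats.MatMul227GF3FootprintKill
import HarnessLib

/-!
# ω-census family (a): `⟨2,2,7⟩ @ 23` over `𝔽₃` — `24 ≤ R_𝔽₃(⟨2,2,7⟩)` conditional ONLY on the completeness of the IRREDUCIBILITY-FREE pencil catalog

Cell `pub-omega` (unit `pub-omega-tensor-g32`), topic `Summits/MatrixMultiplication/OmegaCensus` (sub-folder `SmallFormats`).
Framing (verbatim): lottery ticket; floor = certified bounds/negative ranges. HONEST FRAMING: an ASSEMBLY, twin of `MatMul227GF3FootprintKill`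
(p637099) for a second explicit catalog. `catW2255` lists the 2 255 nine-tuples of `2 × 7` matrices over `𝔽₃` obtained from the block sums
(L_ε | L_ηᵀ | N_u | companion blocks `(C(q), I)` of ARBITRARY monic polynomials `q`, as a multiset sorted by (degree, coefficient code)) with
9 rows and 7 columns (tensor g32 `desk/genW.py`; count 2 255 re-derived by a generating-function count). Its completeness in the kernel-vector
sense, `CatalogCompleteK 7 9 catW2255`, follows from the Weierstraß–Kronecker form with the regular kernel in FIRST natural normal form
(companion blocks of the invariant polynomials — no irreducibility needed; Gantmacher XII §5 + VI §6, BCS 1997 Thm (19.2)/(19.3); finite fields: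
Mirwald 1991 / Dieudonné 1946) — NOT proved in the tree; the point of this twin is that its derivation needs no polynomial irreducibility in Lean.
KERNEL here: every member is Rado-failed by each `REPT j` at `satPoint j` (`radoFails_catW2255`, 6 765 certificates, files
`MatMul227GF3FootprintCerts{0,1,2}W{A,…,E}`), hence `twentyfour_le_tensorRank_227_gf3_of_catalogW2255 : CatalogCompleteK 7 9 catW2255 →
24 ≤ R_𝔽₃(⟨2,2,7⟩)`. Nothing on `ω`; NOT an unconditional proof.
-/

namespace Summit.MatrixMultiplication.OmegaCensus.SmallFormats.Enum723

open Module Matrix Literature.Computability.AlgebraicComplexity RankOnePlaneCapGeneral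

/-- **The irreducibility-free (9,7) catalog**: 2 255 nine-tuples of `2 × 7` matrices over `𝔽₃` (decoded from `catRowsWA ++ ⋯ ++ catRowsWE`). -/
def catW2255 : List (Fin 9 → Matrix (Fin 2) (Fin 7) (ZMod 3)) :=
  (catRowsWA ++ catRowsWB ++ catRowsWC ++ catRowsWD ++ catRowsWE).map decB

/-- The catalog has 2 255 members. -/
theorem catW2255_length : catW2255.length = 2255 := by
  rw [catW2255, List.length_map, List.length_append, List.length_append, List.length_append, List.length_append,
    catRowsWA_length, catRowsWB_length, catRowsWC_length, catRowsWD_length, catRowsWE_length]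

/-- **Every catalog member is Rado-failed** by `REPT j` at `satPoint j`, `j < 3` (6 765 kernel-checked certificates). -/
theorem radoFails_catW2255 : ∀ j, j < 3 → ∀ b ∈ catW2255, RadoFails (REPT j) (satPoint j) b := by
  intro j hj b hb
  rw [catW2255, List.mem_map] at hb
  obtain ⟨rows, hrows, rfl⟩ := hb
  simp only [List.mem_append] at hrows
  rcases hrows with (((h | h) | h) | h) | h
  · obtain ⟨idx, hidx, hget⟩ := List.getElem_of_mem h
    have hD : catRowsWA.getD idx [] = rows := by rw [List.getD_eq_getElem _ _ hidx, hget]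
    rw [catRowsWA_length] at hidx
    rw [← hD]
    interval_cases j
    · exact radoFails_0WA idx hidx
    · exact radoFails_1WA idx hidx
    · exact radoFails_2WA idx hidx
  · obtain ⟨idx, hidx, hget⟩ := List.getElem_of_mem h
    have hD : catRowsWB.getD idx [] = rows := by rw [List.getD_eq_getElem _ _ hidx, hget]
    rw [catRowsWB_length] at hidx
    rw [← hD]
    interval_cases j
    · exact radoFails_0WB idx hidx
    · exact radoFails_1WB idx hidx
    · exact radoFails_2WB idx hidx
  · obtain ⟨idx, hidx, hget⟩ := List.getElem_of_mem h
    have hD : catRowsWC.getD idx [] = rows := by rw [List.getD_eq_getElem _ _ hidx, hget]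
    rw [catRowsWC_length] at hidx
    rw [← hD]
    interval_cases j
    · exact radoFails_0WC idx hidx
    · exact radoFails_1WC idx hidx
    · exact radoFails_2WC idx hidx
  · obtain ⟨idx, hidx, hget⟩ := List.getElem_of_mem h
    have hD : catRowsWD.getD idx [] = rows := by rw [List.getD_eq_getElem _ _ hidx, hget]
    rw [catRowsWD_length] at hidx
    rw [← hD]
    interval_cases j
    · exact radoFails_0WD idx hidx
    · exact radoFails_1WD idx hidx
    · exact radoFails_2WD idx hidx
  · obtain ⟨idx, hidx, hget⟩ := List.getElem_of_mem h
    have hD : catRowsWE.getD idx [] = rows := by rw [List.getD_eq_getElem _ _ hidx, hget]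
    rw [catRowsWE_length] at hidx
    rw [← hD]
    interval_cases j
    · exact radoFails_0WE idx hidx
    · exact radoFails_1WE idx hidx
    · exact radoFails_2WE idx hidx

/-- **`24 ≤ R_𝔽₃(⟨2,2,7⟩)` conditional ONLY on the (kernel-vector) completeness of the explicit irreducibility-free catalog `catW2255`**;
input (R) is discharged by the 6 765 kernel-checked certificates (`radoFails_catW2255`). -/
theorem twentyfour_le_tensorRank_227_gf3_of_catalogW2255 (hcat : CatalogCompleteK 7 9 catW2255) :
    24 ≤ tensorRank (matMulTensor (ZMod 3) 2 2 7) :=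
  twentyfour_le_tensorRank_227_gf3_of_catalogK catW2255 hcat radoFails_catW2255

/-- **`R_𝔽₃(⟨2,2,7⟩) ∈ [24, 25]` conditional only on the completeness of `catW2255`** (ceiling: Hopcroft–Kerr). -/
theorem tensorRank_227_gf3_mem_of_catalogW2255 (hcat : CatalogCompleteK 7 9 catW2255) :
    tensorRank (matMulTensor (ZMod 3) 2 2 7) ∈ Set.Icc 24 25 :=
  ⟨twentyfour_le_tensorRank_227_gf3_of_catalogW2255 hcat, hopcroftKerr1971_tensorRank_matMulTensor_22n_le (K := ZMod 3) 7⟩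

end Summit.MatrixMultiplication.OmegaCensus.SmallFormats.Enum723
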